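import Mathlib
import HarnessLib

/-!
# The branch arrangement of a cyclic cover of ℙ¹ is a projective frame (WEIL-2 gen 31, FERMAT-G31 LEMMA F1, fact-free core)

research route, not a corollary; conditional on HC_CM plus one named minimal statement.

Cell `pub-hodge-ring2-ab-*` (ALL ABELIAN VARIETIES), seat WEIL-2 gen 31, account
`run/shared/lean/pub/pub-hodge-ring2/pub-hodge-ring2-ab-weil-2/FERMAT-G31.md` §2.1 (LEMMA F1).

Informal setting.  THEOREM F of the account identifies Schoen's quotient `W₀ = G̃∖C^h` of the `h`-fold self-product of a cyclic
cover `C → ℙ¹` with `h + 2` branch points `b_j` with a quotient of the Fermat hypersurface `X^h_m`.  Its first step (LEMMA F1) is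
that the `h + 2` evaluation functionals `p ↦ p(b_j)` on the polynomials of degree `≤ h` (whose zero loci are the incidence
hyperplanes `{D ∋ b_j} ⊂ S^hℙ¹ = ℙ^h`) form a projective FRAME: any `h + 1` of them are independent, and the one linear relation
among all `h + 2` — the vanishing of the top divided difference, `Σ_j p(b_j) / ∏_{k ≠ j} (b_j − b_k) = 0` — has ALL coefficients
non-zero.  Hence `(ℙ^h, ∪_j {D ∋ b_j})` is projectively equivalent to the hyperplane `Σ w_j = 0` of `ℙ^{h+1}` with its coordinate
hyperplanes, whatever the (distinct) `b_j`.  This file proves the relation and the non-vanishing of its coefficients over any field,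
via Mathlib's Lagrange interpolation (`Lagrange.eq_interpolate`, `Lagrange.leadingCoeff_basis`).

0 sorry, no `def`, no named fact; `HC_CM` does not occur.
-/

open Polynomial Finset

namespace Summit.HodgeConjecture.Ring2AbelianAll.FermatQuotientFrame

variable {F : Type*} [Field F] {ι : Type*} [DecidableEq ι]

/-- The coefficient of `X^{#s-1}` of the Lagrange interpolant through the nodes `v i` with values `r i` is the top divided
difference `∑_i r_i / ∏_{j ≠ i} (v_i − v_j)` (any field).  [folklore; cf. `Lagrange.leadingCoeff_basis`]
research route, not a corollary; conditional on HC_CM plus one named minimal statement. -/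
theorem interpolate_coeff_card_sub_one (s : Finset ι) (v r : ι → F) (hvs : Set.InjOn v s) :
    (Lagrange.interpolate s v r).coeff (#s - 1) = ∑ i ∈ s, r i / ∏ j ∈ s.erase i, (v i - v j) := by
  rw [Lagrange.interpolate_apply, finsetSum_coeff]
  refine sum_congr rfl fun i hi => ?_
  rw [coeff_C_mul, ← Lagrange.natDegree_basis hvs hi, coeff_natDegree, Lagrange.leadingCoeff_basis hvs hi,
    div_eq_mul_inv]

/-- **LEMMA F1 (the relation).**  If `f` has degree `< #s − 1` — a binary form of degree `≤ h` evaluated at `h + 2 = #s` distinct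
points — then `∑_{i ∈ s} f(v_i) / ∏_{j ≠ i} (v_i − v_j) = 0`: the `h + 2` evaluation functionals satisfy this linear relation
(the top divided difference of `f` at `#s > deg f + 1` nodes vanishes).  [locator FERMAT-G31 §2.1 LEMMA F1 (ii)]
research route, not a corollary; conditional on HC_CM plus one named minimal statement. -/
theorem sum_eval_div_prod_sub_eq_zero (s : Finset ι) (v : ι → F) (hvs : Set.InjOn v s) (f : F[X])
    (hf : f.natDegree + 1 < #s) :
    ∑ i ∈ s, f.eval (v i) / ∏ j ∈ s.erase i, (v i - v j) = 0 := by
  have hdeg : f.degree < #s := by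
    refine lt_of_le_of_lt (degree_le_natDegree) ?_
    exact_mod_cast (show f.natDegree < #s by omega)
  have hint : f = Lagrange.interpolate s v (fun i => f.eval (v i)) := Lagrange.eq_interpolate hvs hdeg
  have hcoeff : f.coeff (#s - 1) = 0 := coeff_eq_zero_of_natDegree_lt (by omega)
  rw [← interpolate_coeff_card_sub_one s v (fun i => f.eval (v i)) hvs, ← hint, hcoeff]

/-- **LEMMA F1 (non-vanishing of the coefficients).**  For distinct nodes every coefficient `1 / ∏_{j ≠ i} (v_i − v_j)` of the
relation is non-zero — so any `#s − 1` of the evaluation functionals are independent and the `#s` of them are a projective frame.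
[locator FERMAT-G31 §2.1 LEMMA F1 (i)–(iii)]  research route, not a corollary; conditional on HC_CM plus one named minimal statement. -/
theorem inv_prod_sub_ne_zero (s : Finset ι) (v : ι → F) (hvs : Set.InjOn v s) {i : ι} (hi : i ∈ s) :
    (∏ j ∈ s.erase i, (v i - v j))⁻¹ ≠ 0 := by
  refine inv_ne_zero (prod_ne_zero_iff.mpr fun j hj => sub_ne_zero.mpr fun h => ?_)
  have hj' := mem_erase.mp hj
  exact hj'.1 (hvs hj'.2 hi h.symm)

/-- **LEMMA F1, evaluation form.**  With `λ_i := (∏_{j ≠ i} (v_i − v_j))⁻¹` (all non-zero by `inv_prod_sub_ne_zero`):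
`∑_i λ_i · f(v_i) = 0` for every polynomial `f` with `natDegree f + 1 < #s`.  For `#s = h + 2` nodes this is the unique relation
among the `h + 2` evaluation functionals on `F[X]_{≤ h}` used in THEOREM F: in the coordinates `w_i := λ_i · ev_{v_i}` the
incidence hyperplanes become the coordinate hyperplanes of `{Σ w_i = 0} ⊂ ℙ^{h+1}`.  [locator FERMAT-G31 §2.1 LEMMA F1 (iii)]
research route, not a corollary; conditional on HC_CM plus one named minimal statement. -/
theorem sum_inv_prod_mul_eval_eq_zero (s : Finset ι) (v : ι → F) (hvs : Set.InjOn v s) (f : F[X])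
    (hf : f.natDegree + 1 < #s) :
    ∑ i ∈ s, (∏ j ∈ s.erase i, (v i - v j))⁻¹ * f.eval (v i) = 0 := by
  have h := sum_eval_div_prod_sub_eq_zero s v hvs f hf
  simpa [div_eq_inv_mul] using h

end Summit.HodgeConjecture.Ring2AbelianAll.FermatQuotientFrame
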